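import Literature.NumberTheory.Automorphic.OrbitalMeasureFamilyRegular
import Literature.NumberTheory.Automorphic.LocalUnitaryGroupUnimodularIsotropic
import Literature.NumberTheory.Rogawski1990.LocalTransfer
import HarnessLib

/-!
# Local orbital measures at the REGULAR classes of `U(H)(L⁺_v)`, `U(Φ_N)(L⁺_v)` and `H(L⁺_v) = U(Φ₂)(L⁺_v) × U(Φ₁)(L⁺_v)`
exist unconditionally (Rogawski (1990), §3.1, §4.3, §4.9, §14.2; Deitmar–Echterhoff (2014), Thm. 1.5.3)

Topic `NumberTheory/Automorphic`; namespace `Literature.NumberTheory.Automorphic.UnitaryGroup`.  THEOREMS ONLY (no definition, no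
instance, no named fact, no `sorry`).  Sequel of ★ `OrbitalMeasureFamilyRegular` (generic half), ★ `LocalOrbitalMeasure`,
★ `UnitaryGroupUnimodularAllRanks`, ★ `LocalUnitaryGroupUnimodularIsotropic`, over the tokens of ★ `Rogawski1990/LocalTransfer`
(`IsRegularElt`, `IsLocalGRegular`).

WHY.  The measure families `m′_v, m_v, mH_v` of the local transfer identities (14.2.1) ∕ (4.3.1) must be `≠ 0`, invariant and finite on
compacts at the classes where the identities are asserted; with Borel σ-algebras this needs the centraliser `G_γ` to be unimodular
(Weil's criterion), which the tree has only for commutative `G_γ`.  The identities are guarded by regularity (`IsRegularElt γ`: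
separable characteristic polynomial; `IsLocalGRegular γ_H`), and a regular element has a COMMUTATIVE centraliser — so at exactly the
guarded classes the families are inhabited with no hypothesis.

* §1 **`centralizer_comm_of_isRegularElt`** (`γ ∈ U(H)(L⁺_v) ≤ GL_N(∏_{w∣v} L_w)` regular ⇒ `G_γ` commutative, ★ `commute_of_charpoly_separable_pi`);
  `exists_localOrbitalMeasure_of_isRegularElt_of_three_le` (rank `N ≥ 3`, every hermitian `H`, `det H ≠ 0`, any Haar `ν`, ANY Haar `ρ`
  on `G_γ`); `exists_localOrbitalMeasure_antidiagOne_of_forall_comm` ∕ `…_of_isRegularElt` (the quasi-split `U(Φ_N)`, every `N`); the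
  FAMILIES **`exists_localOrbitalMeasureFamily_of_three_le`**, **`exists_localOrbitalMeasureFamily_antidiagOne`** (`m_c ≠ 0`, invariant,
  regular, finite on compacts at every class with a regular representative).
* §2 the endoscopic group: `modularCharacter_localEndoscopic_eq_one`, `isMulRightInvariant_localEndoscopic`,
  `isInvInvariant_localEndoscopic` (`H(L⁺_v)` is unimodular — every Haar measure); **`centralizer_comm_of_isLocalGRegular`**
  (`χ_{ι(γ_H)} = χ_{γ₂} · χ_{γ₁}` via ★ `coe_endoGL`, so `γ₂`, `γ₁` are regular in `U(Φ₂)`, `U(Φ₁)`);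
  **`exists_localOrbitalMeasure_endoscopic_of_isLocalGRegular`**; the family **`exists_localOrbitalMeasureFamily_endoscopic`** — the
  `mH` of (4.3.1) ∕ (4.9.1) at every `G`-regular class.

## References
* J. Rogawski, *Automorphic Representations of Unitary Groups in Three Variables* (1990), §3.1 p. 19, §4.3 pp. 42–43, §4.8 p. 53,
  §4.9 pp. 54–55, §14.2 p. 232 [Rogawski1990].
* A. Deitmar, S. Echterhoff, *Principles of Harmonic Analysis*, 2nd ed. (2014), Thm. 1.5.3 [DeitmarEchterhoff2014].
* G. B. Folland, *A Course in Abstract Harmonic Analysis* (1995), §2.4 Prop. 2.27 [Folland1995].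
* R. Ranga Rao, *Orbital integrals in reductive groups*, Ann. of Math. 96 (1972) — the all-classes statement NOT proved here.
-/

noncomputable section

open MeasureTheory Measure NumberField IsDedekindDomain Polynomial
open Literature.MeasureTheory.Group
open scoped Matrix MatrixGroups NNReal

namespace Literature.NumberTheory.Automorphic

/-! ## §1 Local unitary groups: regular elements have commutative centralisers; orbital measures at the regular classes -/

namespace UnitaryGroup

open Literature.LinearAlgebra.Matrix Literature.NumberTheory.Rogawski1990

variable (L : Type) [Field L] [NumberField L] [IsCMField L] {N : ℕ}

/-- **The centraliser of a regular element of `U(H)(L⁺_v)` is commutative**: `γ ∈ U(H)(L⁺_v) ≤ GL_N(∏_{w∣v} L_w)` with separable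
characteristic polynomial (★ `IsRegularElt`); elements of `U(H)(L⁺_v)` commuting with `γ` commute with each other (★ `commute_of_charpoly_separable_pi`
over the product of the fields `L_w`). [cite: Rogawski1990, §3.1 p. 19] -/
theorem centralizer_comm_of_isRegularElt {H : Matrix (Fin N) (Fin N) L} (v : HeightOneSpectrum (𝓞 ↥(maximalRealSubfield L)))
    (γ : (cmDatum L N H).Local v) (hγ : IsRegularElt (γ.val : GL (Fin N) (LocalRing L v))) :
    ∀ a ∈ Subgroup.centralizer ({γ} : Set ((cmDatum L N H).Local v)),
      ∀ b ∈ Subgroup.centralizer ({γ} : Set ((cmDatum L N H).Local v)), a * b = b * a := by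
  intro a ha b hb
  have hc : ∀ {x : (cmDatum L N H).Local v}, x ∈ Subgroup.centralizer ({γ} : Set ((cmDatum L N H).Local v)) →
      Commute (γ.val : GL (Fin N) (LocalRing L v)).val (x.val : GL (Fin N) (LocalRing L v)).val := fun {x} hx => by
    have h1 : (x.val : GL (Fin N) (LocalRing L v)) * γ.val = γ.val * x.val :=
      congrArg Subtype.val (Subgroup.mem_centralizer_singleton_iff.1 hx)
    have h2 := congrArg Units.val h1
    rw [Units.val_mul, Units.val_mul] at h2
    exact h2.symm
  have key := (commute_of_charpoly_separable_pi _ hγ (hc ha) (hc hb)).eq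
  exact Subtype.ext (Units.ext key)

/-- **Orbital measures at the regular classes of `U(H)(L⁺_v)`, rank `N ≥ 3`, exist unconditionally**: `H` hermitian, `det H ≠ 0`,
`γ` regular (`IsRegularElt`), any Haar `ν` on `G_v = U(H)(L⁺_v)` and ANY Haar `ρ` on `G_γ` (commutative, hence unimodular):
a `G_v`-invariant regular `m ≠ 0` on `G_v ⧸ G_γ` with the quotient integral formula (★ `exists_localOrbitalMeasure_of_three_le_of_forall_comm`).
[cite: Rogawski1990, §4.9 p. 54] [cite: DeitmarEchterhoff2014, Thm. 1.5.3] -/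
theorem exists_localOrbitalMeasure_of_isRegularElt_of_three_le (hN : 3 ≤ N) (H : Matrix (Fin N) (Fin N) L)
    (hH : (H.map (cmConjRingHom L))ᵀ = H) (hdet : H.det ≠ 0) (v : HeightOneSpectrum (𝓞 ↥(maximalRealSubfield L)))
    (γ : (cmDatum L N H).Local v) (hγ : IsRegularElt (γ.val : GL (Fin N) (LocalRing L v)))
    [MeasurableSpace ((cmDatum L N H).Local v)] [BorelSpace ((cmDatum L N H).Local v)]
    (ν : Measure ((cmDatum L N H).Local v)) [IsHaarMeasure ν]
    [MeasurableSpace (Subgroup.centralizer ({γ} : Set ((cmDatum L N H).Local v)))]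
    [BorelSpace (Subgroup.centralizer ({γ} : Set ((cmDatum L N H).Local v)))]
    (ρ : Measure (Subgroup.centralizer ({γ} : Set ((cmDatum L N H).Local v)))) [IsHaarMeasure ρ]
    [MeasurableSpace (((cmDatum L N H).Local v) ⧸ Subgroup.centralizer ({γ} : Set ((cmDatum L N H).Local v)))]
    [BorelSpace (((cmDatum L N H).Local v) ⧸ Subgroup.centralizer ({γ} : Set ((cmDatum L N H).Local v)))] :
    ∃ m : Measure (((cmDatum L N H).Local v) ⧸ Subgroup.centralizer ({γ} : Set ((cmDatum L N H).Local v))),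
      SMulInvariantMeasure ((cmDatum L N H).Local v)
          (((cmDatum L N H).Local v) ⧸ Subgroup.centralizer ({γ} : Set ((cmDatum L N H).Local v))) m ∧ m.Regular ∧ m ≠ 0 ∧
        ∀ f : CompactlySupportedContinuousMap ((cmDatum L N H).Local v) ℝ,
          ∫ x, fiberIntegral (Subgroup.centralizer ({γ} : Set ((cmDatum L N H).Local v))) ρ f x ∂m = ∫ g, f g ∂ν :=
  exists_localOrbitalMeasure_of_three_le_of_forall_comm L hN H hH hdet v γ (centralizer_comm_of_isRegularElt L v γ hγ) ν ρ

/-- **The FAMILY of local orbital measures on `U(H)(L⁺_v)` at the regular classes, rank `N ≥ 3`** (`H` hermitian, `det H ≠ 0`):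
`m : OrbitalMeasureFamily (U(H)(L⁺_v))` with `m_c ≠ 0`, `G_v`-invariant, regular and finite on compacts at every class `c` whose
representative is regular — the three measure properties the local transfer identities (14.2.1) ∕ (4.3.1) are stated with, at
exactly the classes their regularity guard lets through. [cite: Rogawski1990, §4.9 p. 54; §14.2 p. 232] -/
theorem exists_localOrbitalMeasureFamily_of_three_le (hN : 3 ≤ N) (H : Matrix (Fin N) (Fin N) L)
    (hH : (H.map (cmConjRingHom L))ᵀ = H) (hdet : H.det ≠ 0) (v : HeightOneSpectrum (𝓞 ↥(maximalRealSubfield L)))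
    [MeasurableSpace ((cmDatum L N H).Local v)] [BorelSpace ((cmDatum L N H).Local v)]
    [∀ γ : (cmDatum L N H).Local v,
      MeasurableSpace (((cmDatum L N H).Local v) ⧸ Subgroup.centralizer ({γ} : Set ((cmDatum L N H).Local v)))]
    [∀ γ : (cmDatum L N H).Local v,
      BorelSpace (((cmDatum L N H).Local v) ⧸ Subgroup.centralizer ({γ} : Set ((cmDatum L N H).Local v)))] :
    ∃ m : OrbitalMeasureFamily ((cmDatum L N H).Local v), ∀ c : ConjClasses ((cmDatum L N H).Local v),
      IsRegularElt ((Quotient.out c).val : GL (Fin N) (LocalRing L v)) →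
        m c ≠ 0 ∧
          SMulInvariantMeasure ((cmDatum L N H).Local v)
            (((cmDatum L N H).Local v) ⧸ Subgroup.centralizer ({(Quotient.out c : (cmDatum L N H).Local v)} :
              Set ((cmDatum L N H).Local v))) (m c) ∧
          (m c).Regular ∧ IsFiniteMeasureOnCompacts (m c) :=
  exists_orbitalMeasureFamily_of_forall_comm (fun g => modularCharacter_cmDatum_local_eq_one_of_three_le L hN H hH hdet v g)
    (fun γ => IsRegularElt (γ.val : GL (Fin N) (LocalRing L v))) (fun γ hγ => centralizer_comm_of_isRegularElt L v γ hγ)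

/-- **Orbital measures on the quasi-split `U(Φ_N)(L⁺_v)` at an element with commutative centraliser — every `N`**, for any Haar `ν` on
the group and ANY Haar `ρ` on the centraliser (★ `isMulRightInvariant_cmDatum_local_antidiagOne`: `U(Φ_N)(L⁺_v)` is unimodular in every
rank). [cite: Rogawski1990, §4.9 p. 54] [cite: DeitmarEchterhoff2014, Thm. 1.5.3] -/
theorem exists_localOrbitalMeasure_antidiagOne_of_forall_comm (N : ℕ) (v : HeightOneSpectrum (𝓞 ↥(maximalRealSubfield L)))
    (γ : (cmDatum L N (Matrix.of fun i j : Fin N => if i.val + j.val + 1 = N then (1 : L) else 0)).Local v)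
    (hcomm : ∀ a ∈ Subgroup.centralizer ({γ} : Set
        ((cmDatum L N (Matrix.of fun i j : Fin N => if i.val + j.val + 1 = N then (1 : L) else 0)).Local v)),
      ∀ b ∈ Subgroup.centralizer ({γ} : Set
        ((cmDatum L N (Matrix.of fun i j : Fin N => if i.val + j.val + 1 = N then (1 : L) else 0)).Local v)), a * b = b * a)
    [MeasurableSpace ((cmDatum L N (Matrix.of fun i j : Fin N => if i.val + j.val + 1 = N then (1 : L) else 0)).Local v)]
    [BorelSpace ((cmDatum L N (Matrix.of fun i j : Fin N => if i.val + j.val + 1 = N then (1 : L) else 0)).Local v)]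
    (ν : Measure ((cmDatum L N (Matrix.of fun i j : Fin N => if i.val + j.val + 1 = N then (1 : L) else 0)).Local v)) [IsHaarMeasure ν]
    [MeasurableSpace (Subgroup.centralizer ({γ} : Set
      ((cmDatum L N (Matrix.of fun i j : Fin N => if i.val + j.val + 1 = N then (1 : L) else 0)).Local v)))]
    [BorelSpace (Subgroup.centralizer ({γ} : Set
      ((cmDatum L N (Matrix.of fun i j : Fin N => if i.val + j.val + 1 = N then (1 : L) else 0)).Local v)))]
    (ρ : Measure (Subgroup.centralizer ({γ} : Set
      ((cmDatum L N (Matrix.of fun i j : Fin N => if i.val + j.val + 1 = N then (1 : L) else 0)).Local v)))) [IsHaarMeasure ρ]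
    [MeasurableSpace (((cmDatum L N (Matrix.of fun i j : Fin N => if i.val + j.val + 1 = N then (1 : L) else 0)).Local v) ⧸
      Subgroup.centralizer ({γ} : Set ((cmDatum L N (Matrix.of fun i j : Fin N => if i.val + j.val + 1 = N then (1 : L) else 0)).Local v)))]
    [BorelSpace (((cmDatum L N (Matrix.of fun i j : Fin N => if i.val + j.val + 1 = N then (1 : L) else 0)).Local v) ⧸
      Subgroup.centralizer ({γ} : Set ((cmDatum L N (Matrix.of fun i j : Fin N => if i.val + j.val + 1 = N then (1 : L) else 0)).Local v)))] :
    ∃ m : Measure (((cmDatum L N (Matrix.of fun i j : Fin N => if i.val + j.val + 1 = N then (1 : L) else 0)).Local v) ⧸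
        Subgroup.centralizer ({γ} : Set ((cmDatum L N (Matrix.of fun i j : Fin N => if i.val + j.val + 1 = N then (1 : L) else 0)).Local v))),
      SMulInvariantMeasure ((cmDatum L N (Matrix.of fun i j : Fin N => if i.val + j.val + 1 = N then (1 : L) else 0)).Local v)
          (((cmDatum L N (Matrix.of fun i j : Fin N => if i.val + j.val + 1 = N then (1 : L) else 0)).Local v) ⧸
            Subgroup.centralizer ({γ} : Set ((cmDatum L N (Matrix.of fun i j : Fin N =>
              if i.val + j.val + 1 = N then (1 : L) else 0)).Local v))) m ∧ m.Regular ∧ m ≠ 0 ∧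
        ∀ f : CompactlySupportedContinuousMap
            ((cmDatum L N (Matrix.of fun i j : Fin N => if i.val + j.val + 1 = N then (1 : L) else 0)).Local v) ℝ,
          ∫ x, fiberIntegral (Subgroup.centralizer ({γ} : Set ((cmDatum L N (Matrix.of fun i j : Fin N =>
              if i.val + j.val + 1 = N then (1 : L) else 0)).Local v))) ρ f x ∂m = ∫ g, f g ∂ν := by
  haveI := isMulRightInvariant_cmDatum_local_antidiagOne L N v ν
  exact exists_smulInvariantMeasure_quotient_centralizer_of_forall_comm γ hcomm ν ρ

/-- **Orbital measures on the quasi-split `U(Φ_N)(L⁺_v)` at a REGULAR element — every `N`**, unconditionally (any Haar `ν`, any Haar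
`ρ` on the centraliser). [cite: Rogawski1990, §4.9 p. 54] [cite: DeitmarEchterhoff2014, Thm. 1.5.3] -/
theorem exists_localOrbitalMeasure_antidiagOne_of_isRegularElt (N : ℕ) (v : HeightOneSpectrum (𝓞 ↥(maximalRealSubfield L)))
    (γ : (cmDatum L N (Matrix.of fun i j : Fin N => if i.val + j.val + 1 = N then (1 : L) else 0)).Local v)
    (hγ : IsRegularElt (γ.val : GL (Fin N) (LocalRing L v)))
    [MeasurableSpace ((cmDatum L N (Matrix.of fun i j : Fin N => if i.val + j.val + 1 = N then (1 : L) else 0)).Local v)]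
    [BorelSpace ((cmDatum L N (Matrix.of fun i j : Fin N => if i.val + j.val + 1 = N then (1 : L) else 0)).Local v)]
    (ν : Measure ((cmDatum L N (Matrix.of fun i j : Fin N => if i.val + j.val + 1 = N then (1 : L) else 0)).Local v)) [IsHaarMeasure ν]
    [MeasurableSpace (Subgroup.centralizer ({γ} : Set
      ((cmDatum L N (Matrix.of fun i j : Fin N => if i.val + j.val + 1 = N then (1 : L) else 0)).Local v)))]
    [BorelSpace (Subgroup.centralizer ({γ} : Set
      ((cmDatum L N (Matrix.of fun i j : Fin N => if i.val + j.val + 1 = N then (1 : L) else 0)).Local v)))]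
    (ρ : Measure (Subgroup.centralizer ({γ} : Set
      ((cmDatum L N (Matrix.of fun i j : Fin N => if i.val + j.val + 1 = N then (1 : L) else 0)).Local v)))) [IsHaarMeasure ρ]
    [MeasurableSpace (((cmDatum L N (Matrix.of fun i j : Fin N => if i.val + j.val + 1 = N then (1 : L) else 0)).Local v) ⧸
      Subgroup.centralizer ({γ} : Set ((cmDatum L N (Matrix.of fun i j : Fin N => if i.val + j.val + 1 = N then (1 : L) else 0)).Local v)))]
    [BorelSpace (((cmDatum L N (Matrix.of fun i j : Fin N => if i.val + j.val + 1 = N then (1 : L) else 0)).Local v) ⧸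
      Subgroup.centralizer ({γ} : Set ((cmDatum L N (Matrix.of fun i j : Fin N => if i.val + j.val + 1 = N then (1 : L) else 0)).Local v)))] :
    ∃ m : Measure (((cmDatum L N (Matrix.of fun i j : Fin N => if i.val + j.val + 1 = N then (1 : L) else 0)).Local v) ⧸
        Subgroup.centralizer ({γ} : Set ((cmDatum L N (Matrix.of fun i j : Fin N => if i.val + j.val + 1 = N then (1 : L) else 0)).Local v))),
      SMulInvariantMeasure ((cmDatum L N (Matrix.of fun i j : Fin N => if i.val + j.val + 1 = N then (1 : L) else 0)).Local v)
          (((cmDatum L N (Matrix.of fun i j : Fin N => if i.val + j.val + 1 = N then (1 : L) else 0)).Local v) ⧸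
            Subgroup.centralizer ({γ} : Set ((cmDatum L N (Matrix.of fun i j : Fin N =>
              if i.val + j.val + 1 = N then (1 : L) else 0)).Local v))) m ∧ m.Regular ∧ m ≠ 0 ∧
        ∀ f : CompactlySupportedContinuousMap
            ((cmDatum L N (Matrix.of fun i j : Fin N => if i.val + j.val + 1 = N then (1 : L) else 0)).Local v) ℝ,
          ∫ x, fiberIntegral (Subgroup.centralizer ({γ} : Set ((cmDatum L N (Matrix.of fun i j : Fin N =>
              if i.val + j.val + 1 = N then (1 : L) else 0)).Local v))) ρ f x ∂m = ∫ g, f g ∂ν :=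
  exists_localOrbitalMeasure_antidiagOne_of_forall_comm L N v γ (centralizer_comm_of_isRegularElt L v γ hγ) ν ρ

/-- **The FAMILY of local orbital measures on the quasi-split `U(Φ_N)(L⁺_v)` at the regular classes — every `N`** (for `N = 3` the
`m_v` of (14.2.1), for `N = 2, 1` the factors of the endoscopic side): `m_c ≠ 0`, invariant, regular, finite on compacts at every
class with a regular representative. [cite: Rogawski1990, §4.9 p. 54; §14.2 p. 232] -/
theorem exists_localOrbitalMeasureFamily_antidiagOne (N : ℕ) (v : HeightOneSpectrum (𝓞 ↥(maximalRealSubfield L)))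
    [MeasurableSpace ((cmDatum L N (Matrix.of fun i j : Fin N => if i.val + j.val + 1 = N then (1 : L) else 0)).Local v)]
    [BorelSpace ((cmDatum L N (Matrix.of fun i j : Fin N => if i.val + j.val + 1 = N then (1 : L) else 0)).Local v)]
    [∀ γ : (cmDatum L N (Matrix.of fun i j : Fin N => if i.val + j.val + 1 = N then (1 : L) else 0)).Local v,
      MeasurableSpace (((cmDatum L N (Matrix.of fun i j : Fin N => if i.val + j.val + 1 = N then (1 : L) else 0)).Local v) ⧸
        Subgroup.centralizer ({γ} : Set ((cmDatum L N (Matrix.of fun i j : Fin N => if i.val + j.val + 1 = N then (1 : L) else 0)).Local v)))]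
    [∀ γ : (cmDatum L N (Matrix.of fun i j : Fin N => if i.val + j.val + 1 = N then (1 : L) else 0)).Local v,
      BorelSpace (((cmDatum L N (Matrix.of fun i j : Fin N => if i.val + j.val + 1 = N then (1 : L) else 0)).Local v) ⧸
        Subgroup.centralizer ({γ} : Set ((cmDatum L N (Matrix.of fun i j : Fin N => if i.val + j.val + 1 = N then (1 : L) else 0)).Local v)))] :
    ∃ m : OrbitalMeasureFamily ((cmDatum L N (Matrix.of fun i j : Fin N => if i.val + j.val + 1 = N then (1 : L) else 0)).Local v),
      ∀ c : ConjClasses ((cmDatum L N (Matrix.of fun i j : Fin N => if i.val + j.val + 1 = N then (1 : L) else 0)).Local v),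
        IsRegularElt ((Quotient.out c).val : GL (Fin N) (LocalRing L v)) →
          m c ≠ 0 ∧
            SMulInvariantMeasure ((cmDatum L N (Matrix.of fun i j : Fin N => if i.val + j.val + 1 = N then (1 : L) else 0)).Local v)
              (((cmDatum L N (Matrix.of fun i j : Fin N => if i.val + j.val + 1 = N then (1 : L) else 0)).Local v) ⧸
                Subgroup.centralizer ({(Quotient.out c :
                  (cmDatum L N (Matrix.of fun i j : Fin N => if i.val + j.val + 1 = N then (1 : L) else 0)).Local v)} :
                  Set ((cmDatum L N (Matrix.of fun i j : Fin N => if i.val + j.val + 1 = N then (1 : L) else 0)).Local v))) (m c) ∧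
            (m c).Regular ∧ IsFiniteMeasureOnCompacts (m c) :=
  exists_orbitalMeasureFamily_of_forall_comm (fun g => modularCharacter_cmDatum_local_antidiagOne_eq_one L N v g)
    (fun γ => IsRegularElt (γ.val : GL (Fin N) (LocalRing L v))) (fun γ hγ => centralizer_comm_of_isRegularElt L v γ hγ)

/-! ## §2 The endoscopic group `H(L⁺_v) = U(Φ₂)(L⁺_v) × U(Φ₁)(L⁺_v)`: unimodular; orbital measures at the `G`-regular classes -/

/-- **`H(L⁺_v) = U(Φ₂)(L⁺_v) × U(Φ₁)(L⁺_v)` is unimodular**: its modular function is trivial (both factors are, ★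
`modularCharacter_cmDatum_local_antidiagOne_eq_one`; ★ `modularCharacterFun_prod_eq_one`). [cite: Rogawski1990, §4.9 p. 54] [cite: Folland1995, §2.4 Prop. 2.27] -/
theorem modularCharacter_localEndoscopic_eq_one (v : HeightOneSpectrum (𝓞 ↥(maximalRealSubfield L)))
    (g : (cmDatum L 2 (Matrix.of fun i j : Fin 2 => if i.val + j.val + 1 = 2 then (1 : L) else 0)).Local v ×
      (cmDatum L 1 (Matrix.of fun i j : Fin 1 => if i.val + j.val + 1 = 1 then (1 : L) else 0)).Local v) :
    modularCharacter g = 1 :=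
  modularCharacterFun_prod_eq_one (fun a => modularCharacter_cmDatum_local_antidiagOne_eq_one L 2 v a)
    (fun b => modularCharacter_cmDatum_local_antidiagOne_eq_one L 1 v b) g

/-- **Every Haar measure on `H(L⁺_v) = U(Φ₂)(L⁺_v) × U(Φ₁)(L⁺_v)` is right invariant.** [cite: Rogawski1990, §4.9 p. 54] -/
theorem isMulRightInvariant_localEndoscopic (v : HeightOneSpectrum (𝓞 ↥(maximalRealSubfield L)))
    [MeasurableSpace ((cmDatum L 2 (Matrix.of fun i j : Fin 2 => if i.val + j.val + 1 = 2 then (1 : L) else 0)).Local v ×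
      (cmDatum L 1 (Matrix.of fun i j : Fin 1 => if i.val + j.val + 1 = 1 then (1 : L) else 0)).Local v)]
    [BorelSpace ((cmDatum L 2 (Matrix.of fun i j : Fin 2 => if i.val + j.val + 1 = 2 then (1 : L) else 0)).Local v ×
      (cmDatum L 1 (Matrix.of fun i j : Fin 1 => if i.val + j.val + 1 = 1 then (1 : L) else 0)).Local v)]
    (ν : Measure ((cmDatum L 2 (Matrix.of fun i j : Fin 2 => if i.val + j.val + 1 = 2 then (1 : L) else 0)).Local v ×
      (cmDatum L 1 (Matrix.of fun i j : Fin 1 => if i.val + j.val + 1 = 1 then (1 : L) else 0)).Local v)) [IsHaarMeasure ν] :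
    ν.IsMulRightInvariant :=
  isMulRightInvariant_prod (fun a => modularCharacter_cmDatum_local_antidiagOne_eq_one L 2 v a)
    (fun b => modularCharacter_cmDatum_local_antidiagOne_eq_one L 1 v b) ν

/-- **Every Haar measure on `H(L⁺_v) = U(Φ₂)(L⁺_v) × U(Φ₁)(L⁺_v)` is inversion invariant.** [cite: Rogawski1990, §4.9 p. 54] -/
theorem isInvInvariant_localEndoscopic (v : HeightOneSpectrum (𝓞 ↥(maximalRealSubfield L)))
    [MeasurableSpace ((cmDatum L 2 (Matrix.of fun i j : Fin 2 => if i.val + j.val + 1 = 2 then (1 : L) else 0)).Local v ×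
      (cmDatum L 1 (Matrix.of fun i j : Fin 1 => if i.val + j.val + 1 = 1 then (1 : L) else 0)).Local v)]
    [BorelSpace ((cmDatum L 2 (Matrix.of fun i j : Fin 2 => if i.val + j.val + 1 = 2 then (1 : L) else 0)).Local v ×
      (cmDatum L 1 (Matrix.of fun i j : Fin 1 => if i.val + j.val + 1 = 1 then (1 : L) else 0)).Local v)]
    (ν : Measure ((cmDatum L 2 (Matrix.of fun i j : Fin 2 => if i.val + j.val + 1 = 2 then (1 : L) else 0)).Local v ×
      (cmDatum L 1 (Matrix.of fun i j : Fin 1 => if i.val + j.val + 1 = 1 then (1 : L) else 0)).Local v)) [IsHaarMeasure ν] :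
    ν.IsInvInvariant :=
  isInvInvariant_prod (fun a => modularCharacter_cmDatum_local_antidiagOne_eq_one L 2 v a)
    (fun b => modularCharacter_cmDatum_local_antidiagOne_eq_one L 1 v b) ν

/-- **The centraliser of a `G`-regular `γ_H ∈ H(L⁺_v)` is commutative**: `IsLocalGRegular γ_H` says `χ_{ι(γ_H)} = χ_{γ₂} · χ_{γ₁}`
(★ `coe_endoGL`: `ι(γ₂, γ₁) = reindex (γ₂ ⊕ γ₁)`) is separable, so `χ_{γ₂}` is separable and the centraliser of `γ₂` in `U(Φ₂)(L⁺_v)`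
is commutative (§1), and likewise `χ_{γ₁}` for the factor `U(Φ₁)(L⁺_v)`. [cite: Rogawski1990, §4.3 p. 42] -/
theorem centralizer_comm_of_isLocalGRegular (v : HeightOneSpectrum (𝓞 ↥(maximalRealSubfield L)))
    (γH : (cmDatum L 2 (Matrix.of fun i j : Fin 2 => if i.val + j.val + 1 = 2 then (1 : L) else 0)).Local v ×
      (cmDatum L 1 (Matrix.of fun i j : Fin 1 => if i.val + j.val + 1 = 1 then (1 : L) else 0)).Local v)
    (hγ : IsLocalGRegular L v γH) :
    ∀ a ∈ Subgroup.centralizer ({γH} : Set ((cmDatum L 2 (Matrix.of fun i j : Fin 2 => if i.val + j.val + 1 = 2 then (1 : L) else 0)).Local v ×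
        (cmDatum L 1 (Matrix.of fun i j : Fin 1 => if i.val + j.val + 1 = 1 then (1 : L) else 0)).Local v)),
      ∀ b ∈ Subgroup.centralizer ({γH} : Set ((cmDatum L 2 (Matrix.of fun i j : Fin 2 => if i.val + j.val + 1 = 2 then (1 : L) else 0)).Local v ×
        (cmDatum L 1 (Matrix.of fun i j : Fin 1 => if i.val + j.val + 1 = 1 then (1 : L) else 0)).Local v)), a * b = b * a := by
  have hsep : ((γH.1.val : GL (Fin 2) (LocalRing L v)).val.charpoly *
      (γH.2.val : GL (Fin 1) (LocalRing L v)).val.charpoly).Separable := by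
    have h := hγ
    simp only [IsLocalGRegular, IsGRegular, IsRegularElt, coe_endoEmb, coe_endoGL, Matrix.charpoly_reindex,
      Matrix.charpoly_fromBlocks_zero₁₂] at h
    exact h
  obtain ⟨γ₂, γ₁⟩ := γH
  exact centralizer_prod_comm γ₂ γ₁ (centralizer_comm_of_isRegularElt L v γ₂ hsep.of_mul_left)
    (centralizer_comm_of_isRegularElt L v γ₁ hsep.of_mul_right)

/-- **Orbital measures on `H(L⁺_v) = U(Φ₂)(L⁺_v) × U(Φ₁)(L⁺_v)` at a `G`-REGULAR `γ_H` exist unconditionally**: for any Haar `ν` on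
`H(L⁺_v)` and ANY Haar `ρ` on the (commutative) centraliser `H_{γ_H}`, an `H(L⁺_v)`-invariant regular `m ≠ 0` on `H(L⁺_v) ⧸ H_{γ_H}`
with the quotient integral formula — the measure of `Φ^{st}_H(γ_H, f^H_v)` in (4.3.1) ∕ (4.9.1).
[cite: Rogawski1990, §4.3 (4.3.1) p. 43; §4.9 p. 54] [cite: DeitmarEchterhoff2014, Thm. 1.5.3] -/
theorem exists_localOrbitalMeasure_endoscopic_of_isLocalGRegular (v : HeightOneSpectrum (𝓞 ↥(maximalRealSubfield L)))
    (γH : (cmDatum L 2 (Matrix.of fun i j : Fin 2 => if i.val + j.val + 1 = 2 then (1 : L) else 0)).Local v ×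
      (cmDatum L 1 (Matrix.of fun i j : Fin 1 => if i.val + j.val + 1 = 1 then (1 : L) else 0)).Local v)
    (hγ : IsLocalGRegular L v γH)
    [MeasurableSpace ((cmDatum L 2 (Matrix.of fun i j : Fin 2 => if i.val + j.val + 1 = 2 then (1 : L) else 0)).Local v ×
      (cmDatum L 1 (Matrix.of fun i j : Fin 1 => if i.val + j.val + 1 = 1 then (1 : L) else 0)).Local v)]
    [BorelSpace ((cmDatum L 2 (Matrix.of fun i j : Fin 2 => if i.val + j.val + 1 = 2 then (1 : L) else 0)).Local v ×
      (cmDatum L 1 (Matrix.of fun i j : Fin 1 => if i.val + j.val + 1 = 1 then (1 : L) else 0)).Local v)]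
    (ν : Measure ((cmDatum L 2 (Matrix.of fun i j : Fin 2 => if i.val + j.val + 1 = 2 then (1 : L) else 0)).Local v ×
      (cmDatum L 1 (Matrix.of fun i j : Fin 1 => if i.val + j.val + 1 = 1 then (1 : L) else 0)).Local v)) [IsHaarMeasure ν]
    [MeasurableSpace (Subgroup.centralizer ({γH} : Set ((cmDatum L 2 (Matrix.of fun i j : Fin 2 => if i.val + j.val + 1 = 2 then (1 : L) else 0)).Local v ×
      (cmDatum L 1 (Matrix.of fun i j : Fin 1 => if i.val + j.val + 1 = 1 then (1 : L) else 0)).Local v)))]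
    [BorelSpace (Subgroup.centralizer ({γH} : Set ((cmDatum L 2 (Matrix.of fun i j : Fin 2 => if i.val + j.val + 1 = 2 then (1 : L) else 0)).Local v ×
      (cmDatum L 1 (Matrix.of fun i j : Fin 1 => if i.val + j.val + 1 = 1 then (1 : L) else 0)).Local v)))]
    (ρ : Measure (Subgroup.centralizer ({γH} : Set ((cmDatum L 2 (Matrix.of fun i j : Fin 2 => if i.val + j.val + 1 = 2 then (1 : L) else 0)).Local v ×
      (cmDatum L 1 (Matrix.of fun i j : Fin 1 => if i.val + j.val + 1 = 1 then (1 : L) else 0)).Local v)))) [IsHaarMeasure ρ]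
    [MeasurableSpace (((cmDatum L 2 (Matrix.of fun i j : Fin 2 => if i.val + j.val + 1 = 2 then (1 : L) else 0)).Local v ×
      (cmDatum L 1 (Matrix.of fun i j : Fin 1 => if i.val + j.val + 1 = 1 then (1 : L) else 0)).Local v) ⧸
      Subgroup.centralizer ({γH} : Set ((cmDatum L 2 (Matrix.of fun i j : Fin 2 => if i.val + j.val + 1 = 2 then (1 : L) else 0)).Local v ×
      (cmDatum L 1 (Matrix.of fun i j : Fin 1 => if i.val + j.val + 1 = 1 then (1 : L) else 0)).Local v)))]
    [BorelSpace (((cmDatum L 2 (Matrix.of fun i j : Fin 2 => if i.val + j.val + 1 = 2 then (1 : L) else 0)).Local v ×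
      (cmDatum L 1 (Matrix.of fun i j : Fin 1 => if i.val + j.val + 1 = 1 then (1 : L) else 0)).Local v) ⧸
      Subgroup.centralizer ({γH} : Set ((cmDatum L 2 (Matrix.of fun i j : Fin 2 => if i.val + j.val + 1 = 2 then (1 : L) else 0)).Local v ×
      (cmDatum L 1 (Matrix.of fun i j : Fin 1 => if i.val + j.val + 1 = 1 then (1 : L) else 0)).Local v)))] :
    ∃ m : Measure (((cmDatum L 2 (Matrix.of fun i j : Fin 2 => if i.val + j.val + 1 = 2 then (1 : L) else 0)).Local v ×
      (cmDatum L 1 (Matrix.of fun i j : Fin 1 => if i.val + j.val + 1 = 1 then (1 : L) else 0)).Local v) ⧸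
      Subgroup.centralizer ({γH} : Set ((cmDatum L 2 (Matrix.of fun i j : Fin 2 => if i.val + j.val + 1 = 2 then (1 : L) else 0)).Local v ×
      (cmDatum L 1 (Matrix.of fun i j : Fin 1 => if i.val + j.val + 1 = 1 then (1 : L) else 0)).Local v))),
      SMulInvariantMeasure ((cmDatum L 2 (Matrix.of fun i j : Fin 2 => if i.val + j.val + 1 = 2 then (1 : L) else 0)).Local v ×
      (cmDatum L 1 (Matrix.of fun i j : Fin 1 => if i.val + j.val + 1 = 1 then (1 : L) else 0)).Local v)
        (((cmDatum L 2 (Matrix.of fun i j : Fin 2 => if i.val + j.val + 1 = 2 then (1 : L) else 0)).Local v ×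
      (cmDatum L 1 (Matrix.of fun i j : Fin 1 => if i.val + j.val + 1 = 1 then (1 : L) else 0)).Local v) ⧸
          Subgroup.centralizer ({γH} : Set ((cmDatum L 2 (Matrix.of fun i j : Fin 2 => if i.val + j.val + 1 = 2 then (1 : L) else 0)).Local v ×
      (cmDatum L 1 (Matrix.of fun i j : Fin 1 => if i.val + j.val + 1 = 1 then (1 : L) else 0)).Local v))) m ∧ m.Regular ∧ m ≠ 0 ∧
        ∀ f : CompactlySupportedContinuousMap ((cmDatum L 2 (Matrix.of fun i j : Fin 2 => if i.val + j.val + 1 = 2 then (1 : L) else 0)).Local v ×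
      (cmDatum L 1 (Matrix.of fun i j : Fin 1 => if i.val + j.val + 1 = 1 then (1 : L) else 0)).Local v) ℝ,
          ∫ x, fiberIntegral (Subgroup.centralizer ({γH} : Set ((cmDatum L 2 (Matrix.of fun i j : Fin 2 => if i.val + j.val + 1 = 2 then (1 : L) else 0)).Local v ×
      (cmDatum L 1 (Matrix.of fun i j : Fin 1 => if i.val + j.val + 1 = 1 then (1 : L) else 0)).Local v))) ρ f x ∂m = ∫ g, f g ∂ν := by
  haveI := isMulRightInvariant_localEndoscopic L v ν
  exact exists_smulInvariantMeasure_quotient_centralizer_of_forall_comm γH (centralizer_comm_of_isLocalGRegular L v γH hγ) ν ρ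

/-- **The FAMILY `mH` of local orbital measures on `H(L⁺_v) = U(Φ₂)(L⁺_v) × U(Φ₁)(L⁺_v)` at the `G`-regular classes**: a member
`≠ 0`, `H(L⁺_v)`-invariant, regular and finite on compacts at every class whose representative is `G`-regular (★ `IsLocalGRegular`) —
the three measure properties of (4.3.1) ∕ (4.9.1) at exactly the classes its guard lets through. [cite: Rogawski1990, §4.3 (4.3.1) p. 43; §4.9 (4.9.1) p. 55] -/
theorem exists_localOrbitalMeasureFamily_endoscopic (v : HeightOneSpectrum (𝓞 ↥(maximalRealSubfield L)))
    [MeasurableSpace ((cmDatum L 2 (Matrix.of fun i j : Fin 2 => if i.val + j.val + 1 = 2 then (1 : L) else 0)).Local v ×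
      (cmDatum L 1 (Matrix.of fun i j : Fin 1 => if i.val + j.val + 1 = 1 then (1 : L) else 0)).Local v)]
    [BorelSpace ((cmDatum L 2 (Matrix.of fun i j : Fin 2 => if i.val + j.val + 1 = 2 then (1 : L) else 0)).Local v ×
      (cmDatum L 1 (Matrix.of fun i j : Fin 1 => if i.val + j.val + 1 = 1 then (1 : L) else 0)).Local v)]
    [∀ a : ((cmDatum L 2 (Matrix.of fun i j : Fin 2 => if i.val + j.val + 1 = 2 then (1 : L) else 0)).Local v ×
      (cmDatum L 1 (Matrix.of fun i j : Fin 1 => if i.val + j.val + 1 = 1 then (1 : L) else 0)).Local v),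
      MeasurableSpace (((cmDatum L 2 (Matrix.of fun i j : Fin 2 => if i.val + j.val + 1 = 2 then (1 : L) else 0)).Local v ×
      (cmDatum L 1 (Matrix.of fun i j : Fin 1 => if i.val + j.val + 1 = 1 then (1 : L) else 0)).Local v) ⧸
        Subgroup.centralizer ({a} : Set ((cmDatum L 2 (Matrix.of fun i j : Fin 2 => if i.val + j.val + 1 = 2 then (1 : L) else 0)).Local v ×
      (cmDatum L 1 (Matrix.of fun i j : Fin 1 => if i.val + j.val + 1 = 1 then (1 : L) else 0)).Local v)))]
    [∀ a : ((cmDatum L 2 (Matrix.of fun i j : Fin 2 => if i.val + j.val + 1 = 2 then (1 : L) else 0)).Local v ×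
      (cmDatum L 1 (Matrix.of fun i j : Fin 1 => if i.val + j.val + 1 = 1 then (1 : L) else 0)).Local v),
      BorelSpace (((cmDatum L 2 (Matrix.of fun i j : Fin 2 => if i.val + j.val + 1 = 2 then (1 : L) else 0)).Local v ×
      (cmDatum L 1 (Matrix.of fun i j : Fin 1 => if i.val + j.val + 1 = 1 then (1 : L) else 0)).Local v) ⧸
        Subgroup.centralizer ({a} : Set ((cmDatum L 2 (Matrix.of fun i j : Fin 2 => if i.val + j.val + 1 = 2 then (1 : L) else 0)).Local v ×
      (cmDatum L 1 (Matrix.of fun i j : Fin 1 => if i.val + j.val + 1 = 1 then (1 : L) else 0)).Local v)))] :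
    ∃ mH : OrbitalMeasureFamily ((cmDatum L 2 (Matrix.of fun i j : Fin 2 => if i.val + j.val + 1 = 2 then (1 : L) else 0)).Local v ×
      (cmDatum L 1 (Matrix.of fun i j : Fin 1 => if i.val + j.val + 1 = 1 then (1 : L) else 0)).Local v),
      ∀ c : ConjClasses ((cmDatum L 2 (Matrix.of fun i j : Fin 2 => if i.val + j.val + 1 = 2 then (1 : L) else 0)).Local v ×
      (cmDatum L 1 (Matrix.of fun i j : Fin 1 => if i.val + j.val + 1 = 1 then (1 : L) else 0)).Local v), IsLocalGRegular L v (Quotient.out c) →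
        mH c ≠ 0 ∧
          SMulInvariantMeasure ((cmDatum L 2 (Matrix.of fun i j : Fin 2 => if i.val + j.val + 1 = 2 then (1 : L) else 0)).Local v ×
      (cmDatum L 1 (Matrix.of fun i j : Fin 1 => if i.val + j.val + 1 = 1 then (1 : L) else 0)).Local v)
            (((cmDatum L 2 (Matrix.of fun i j : Fin 2 => if i.val + j.val + 1 = 2 then (1 : L) else 0)).Local v ×
      (cmDatum L 1 (Matrix.of fun i j : Fin 1 => if i.val + j.val + 1 = 1 then (1 : L) else 0)).Local v) ⧸
              Subgroup.centralizer ({(Quotient.out c : ((cmDatum L 2 (Matrix.of fun i j : Fin 2 => if i.val + j.val + 1 = 2 then (1 : L) else 0)).Local v × (cmDatum L 1 (Matrix.of fun i j : Fin 1 => if i.val + j.val + 1 = 1 then (1 : L) else 0)).Local v))} :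
                Set ((cmDatum L 2 (Matrix.of fun i j : Fin 2 => if i.val + j.val + 1 = 2 then (1 : L) else 0)).Local v ×
      (cmDatum L 1 (Matrix.of fun i j : Fin 1 => if i.val + j.val + 1 = 1 then (1 : L) else 0)).Local v))) (mH c) ∧
          (mH c).Regular ∧ IsFiniteMeasureOnCompacts (mH c) :=
  exists_orbitalMeasureFamily_of_forall_comm (fun g => modularCharacter_localEndoscopic_eq_one L v g) (IsLocalGRegular L v)
    (fun γ hγ => centralizer_comm_of_isLocalGRegular L v γ hγ)

end UnitaryGroup

end Literature.NumberTheory.Automorphic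

end
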